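import Mathlib.Probability.Kernel.MeasurableIntegral
import Mathlib.Probability.Kernel.Composition.MapComap
import Mathlib.MeasureTheory.Integral.Prod
import Literature.Analysis.FluidPDE.BallisticFreeEnergy
import HarnessLib

/-!
# Integrability of Young-measure averages; continuity of the temperature map

Measure-theoretic glue for the weak–strong uniqueness argument of Březina–Feireisl 2018 in the
framework of `DissipativeMVEuler.lean`, where a Young measure is a Markov kernel
`Y : Kernel (ℝ × 𝕋³) EulerPhase` and brackets `⟨Y_{t,x}; g⟩` are Bochner integrals:

* `integrable_kernel_integral` — if `‖g x w‖ ≤ a F(w) + b` and `∫⁻∫⁻ F dκ dμ < ∞` (the shape of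
  the moment bound (2.8)–(2.11) / field `moment_bound`), then `g x` is `κ x`-integrable for a.e.
  `x`, `x ↦ ∫ g x dκ x` is `μ`-integrable, and `∫⁻ ‖∫ g x dκ x‖ ≤ a ∫⁻∫⁻F + b μ(univ)`;
* `ae_restrict_prod_lintegral_lt_top` — an a.e.-in-time family of slice bounds gives a
  product-a.e. finiteness statement on `(0,T) × 𝕋³`;
* `EulerEOS.continuousOn_temperature` — the temperature `ϑ(ρ,E)` inverting `E = ρ e(ρ,ϑ)` is
  jointly continuous on the open quadrant (strict monotonicity of `e` in `ϑ` plus continuity of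
  `e`; no differentiability of `ϑ(ρ,E)` is ever needed), whence measurability of the
  thermodynamic integrands after modification off the quadrant (`measurable_quadrantPiecewise`).

## References

* J. Březina, E. Feireisl, J. Math. Soc. Japan 70 (2018), §2.2 (identification of functions of
  `(ρ,ϑ)` with functions of `(ρ,E)`), Def. 2.9.
-/

noncomputable section

open MeasureTheory ProbabilityTheory Set Filter Function
open scoped ENNReal Topology

namespace Literature.Analysis.FluidPDE

namespace CompressibleEuler

/-! ## Integrability of kernel averages from a moment bound -/

section Kernel

variable {α β : Type*} [MeasurableSpace α] [MeasurableSpace β] {μ : Measure α} {κ : Kernel α β}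

/-- **Integrability of kernel averages from a moment bound.** Let `κ` be a Markov kernel, `μ` a
finite measure, `g : α → β → ℝ` jointly measurable with `‖g x w‖ ≤ a F(w) + b` (`κ x`-a.e., for
`μ`-a.e. `x`) for a measurable `F ≥ 0` with `∫⁻ x, ∫⁻ w, F w ∂κ x ∂μ < ∞`. Then `g x` is
`κ x`-integrable for a.e. `x`, `x ↦ ∫ g x dκ x` is integrable, and
`∫⁻ ‖∫ g x dκ x‖ₑ dμ ≤ a ∫⁻∫⁻ F + b μ univ`. [folklore] -/
theorem integrable_kernel_integral [IsFiniteMeasure μ] [IsMarkovKernel κ] {g : α → β → ℝ}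
    (hg : Measurable (uncurry g)) {F : β → ℝ≥0∞} (hF : Measurable F) {a b : ℝ≥0∞} (ha : a ≠ ∞)
    (hb : b ≠ ∞) (hbound : ∀ᵐ x ∂μ, ∀ᵐ w ∂κ x, ‖g x w‖ₑ ≤ a * F w + b)
    (hC : ∫⁻ x, ∫⁻ w, F w ∂κ x ∂μ ≠ ∞) :
    (∀ᵐ x ∂μ, Integrable (g x) (κ x)) ∧ Integrable (fun x => ∫ w, g x w ∂κ x) μ ∧
      ∫⁻ x, ‖∫ w, g x w ∂κ x‖ₑ ∂μ ≤ a * ∫⁻ x, ∫⁻ w, F w ∂κ x ∂μ + b * μ univ := by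
  have hgx : ∀ x, Measurable (g x) := fun x => hg.of_uncurry_left
  -- pointwise bound on the inner `L¹` norms
  have hinner : ∀ᵐ x ∂μ, ∫⁻ w, ‖g x w‖ₑ ∂κ x ≤ a * ∫⁻ w, F w ∂κ x + b := by
    filter_upwards [hbound] with x hx
    calc ∫⁻ w, ‖g x w‖ₑ ∂κ x ≤ ∫⁻ w, a * F w + b ∂κ x := lintegral_mono_ae hx
      _ = a * ∫⁻ w, F w ∂κ x + b := by
          rw [lintegral_add_right _ measurable_const, lintegral_const_mul _ hF, lintegral_const]
          simp
  -- a.e. finiteness of the moment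
  have hfin : ∀ᵐ x ∂μ, ∫⁻ w, F w ∂κ x < ∞ := ae_lt_top (hF.lintegral_kernel) hC
  have h1 : ∀ᵐ x ∂μ, Integrable (g x) (κ x) := by
    filter_upwards [hinner, hfin] with x hx hx'
    refine ⟨(hgx x).aestronglyMeasurable, ?_⟩
    rw [hasFiniteIntegral_iff_enorm]
    refine lt_of_le_of_lt hx ?_
    exact ENNReal.add_lt_top.2 ⟨ENNReal.mul_lt_top ha.lt_top hx', hb.lt_top⟩
  have hsm : StronglyMeasurable fun x => ∫ w, g x w ∂κ x :=
    hg.stronglyMeasurable.integral_kernel_prod_right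
  have h3 : ∫⁻ x, ‖∫ w, g x w ∂κ x‖ₑ ∂μ ≤ a * ∫⁻ x, ∫⁻ w, F w ∂κ x ∂μ + b * μ univ := by
    calc ∫⁻ x, ‖∫ w, g x w ∂κ x‖ₑ ∂μ ≤ ∫⁻ x, ∫⁻ w, ‖g x w‖ₑ ∂κ x ∂μ :=
          lintegral_mono fun x => enorm_integral_le_lintegral_enorm _
      _ ≤ ∫⁻ x, a * ∫⁻ w, F w ∂κ x + b ∂μ := lintegral_mono_ae hinner
      _ = a * ∫⁻ x, ∫⁻ w, F w ∂κ x ∂μ + b * μ univ := by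
          rw [lintegral_add_right _ measurable_const, lintegral_const_mul _ hF.lintegral_kernel,
            lintegral_const]
  refine ⟨h1, ⟨hsm.aestronglyMeasurable, ?_⟩, h3⟩
  rw [hasFiniteIntegral_iff_enorm]
  refine lt_of_le_of_lt h3 (ENNReal.add_lt_top.2 ⟨ENNReal.mul_lt_top ha.lt_top hC.lt_top, ?_⟩)
  exact ENNReal.mul_lt_top hb.lt_top (measure_lt_top μ univ)

end Kernel

/-! ## From slice bounds to product-a.e. statements on `(0,T) × 𝕋³` -/

section Slices

variable {Ω β : Type*} [MeasurableSpace Ω] [MeasurableSpace β] {ν : Measure Ω} [SFinite ν]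

/-- The slice at time `τ` of a kernel on `ℝ × Ω`. [folklore] -/
def sliceKernel (Y : Kernel (ℝ × Ω) β) (τ : ℝ) : Kernel Ω β :=
  Kernel.comap Y (Prod.mk τ) measurable_prodMk_left

omit [SFinite ν] in
/-- `sliceKernel Y τ x = Y (τ, x)`. [folklore] -/
@[simp] theorem sliceKernel_apply (Y : Kernel (ℝ × Ω) β) (τ : ℝ) (x : Ω) :
    sliceKernel Y τ x = Y (τ, x) := rfl

omit [SFinite ν] in
/-- Slices of Markov kernels are Markov. [folklore] -/
instance (Y : Kernel (ℝ × Ω) β) [IsMarkovKernel Y] (τ : ℝ) : IsMarkovKernel (sliceKernel Y τ) := by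
  unfold sliceKernel; infer_instance

/-- **From a.e.-in-time slice bounds to product-a.e. finiteness.** If for a.e. `τ ∈ S`
the slice integrals `∫⁻ x, G (τ, x) dν` are finite for a measurable `G ≥ 0`,
then `G < ∞` a.e. on `S × Ω` for the product measure. [folklore] -/
theorem ae_restrict_prod_lt_top {G : ℝ × Ω → ℝ≥0∞} (hG : Measurable G) {S : Set ℝ}
    (h : ∀ᵐ τ ∂(volume.restrict S), ∫⁻ x, G (τ, x) ∂ν ≠ ∞) :
    ∀ᵐ z ∂((volume.restrict S).prod ν), G z < ∞ := by
  have hmeas : MeasurableSet {z : ℝ × Ω | G z < ∞} := measurableSet_lt hG measurable_const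
  change ∀ᵐ z ∂((volume.restrict S).prod ν), z ∈ {z : ℝ × Ω | G z < ∞}
  rw [Measure.ae_prod_mem_iff_ae_ae_mem hmeas]
  filter_upwards [h] with τ hτ
  exact ae_lt_top (hG.comp measurable_prodMk_left) hτ

end Slices

/-! ## Measurable modification off the open quadrant -/

section Quadrant

variable {γ : Type*} [MeasurableSpace γ] [TopologicalSpace γ] [OpensMeasurableSpace γ]

/-- A function continuous on a measurable set, modified to `0` off it, is measurable
(`ContinuousOn.measurable_piecewise`). [folklore] -/
theorem measurable_piecewise_zero {f : γ → ℝ} {s : Set γ} [∀ x, Decidable (x ∈ s)]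
    (hf : ContinuousOn f s) (hs : MeasurableSet s) : Measurable (s.piecewise f 0) :=
  hf.measurable_piecewise continuousOn_const hs

omit [TopologicalSpace γ] [OpensMeasurableSpace γ] in
/-- If a measure does not charge the complement of `s`, integrals of `f` and of its modification
off `s` agree. [folklore] -/
theorem integral_piecewise_zero_eq {μ : Measure γ} {f : γ → ℝ} {s : Set γ} [∀ x, Decidable (x ∈ s)]
    (hμ : ∀ᵐ x ∂μ, x ∈ s) : ∫ x, s.piecewise f 0 x ∂μ = ∫ x, f x ∂μ := by
  refine integral_congr_ae ?_
  filter_upwards [hμ] with x hx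
  simp [Set.piecewise, hx]

omit [TopologicalSpace γ] [OpensMeasurableSpace γ] in
/-- Same for lower Lebesgue integrals of `ofReal`. [folklore] -/
theorem lintegral_piecewise_zero_eq {μ : Measure γ} {f : γ → ℝ} {s : Set γ}
    [∀ x, Decidable (x ∈ s)] (hμ : ∀ᵐ x ∂μ, x ∈ s) :
    ∫⁻ x, ENNReal.ofReal (s.piecewise f 0 x) ∂μ = ∫⁻ x, ENNReal.ofReal (f x) ∂μ := by
  refine lintegral_congr_ae ?_
  filter_upwards [hμ] with x hx
  simp [Set.piecewise, hx]

/-- A function continuous on `s` is a.e.-strongly measurable for every finite measure carried by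
`s`. [folklore] -/
theorem aestronglyMeasurable_of_continuousOn_of_ae_mem {μ : Measure γ} {f : γ → ℝ} {s : Set γ}
    (hf : ContinuousOn f s) (hs : MeasurableSet s) (hμ : ∀ᵐ x ∂μ, x ∈ s) :
    AEStronglyMeasurable f μ := by
  classical
  have h1 : Measurable (s.piecewise f 0) := measurable_piecewise_zero hf hs
  refine ⟨s.piecewise f 0, h1.stronglyMeasurable, ?_⟩
  filter_upwards [hμ] with x hx
  simp [Set.piecewise, hx]

end Quadrant

/-! ## Continuity of the temperature map on the open quadrant -/

namespace EulerEOS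

variable {eos : EulerEOS}

/-- `ϑ ↦ e(ρ,ϑ)` is strictly increasing on `(0,∞)` (thermodynamic stability `∂_ϑ e > 0`).
[cite: BrezinaFeireisl2018, (2.19)] -/
theorem strictMonoOn_e (hG : eos.IsGibbs) (hS : eos.IsThermodynamicallyStable) {ρ : ℝ}
    (hρ : 0 < ρ) : StrictMonoOn (fun θ => eos.e ρ θ) (Ioi 0) := by
  refine strictMonoOn_of_deriv_pos (convex_Ioi 0) (fun θ hθ => ?_) fun θ hθ => ?_
  · exact (hG.hasDerivAt_e_theta hρ hθ).continuousAt.continuousWithinAt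
  · rw [interior_Ioi] at hθ
    exact (hS ρ θ hρ hθ).2

/-- **Joint continuity of the temperature `ϑ(ρ,E)`** on the open quadrant, for an equation of
state with Gibbs' relation, thermodynamic stability and a temperature inversion that is a genuine
inverse of `ϑ ↦ ρ e(ρ,ϑ)` there: `ϑ(ρ,E)` is squeezed between `ϑ₀ ± ε` as soon as
`ρ e(ρ, ϑ₀ - ε) < E < ρ e(ρ, ϑ₀ + ε)`, an open condition in `(ρ,E)`.
[cite: BrezinaFeireisl2018, §2.2] -/
theorem continuousOn_temperature (hG : eos.IsGibbs) (hS : eos.IsThermodynamicallyStable)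
    (htemp : ∀ r E : ℝ, 0 < r → 0 < E →
      0 < eos.temperature r E ∧ r * eos.e r (eos.temperature r E) = E) :
    ContinuousOn (fun q : ℝ × ℝ => eos.temperature q.1 q.2) (Ioi 0 ×ˢ Ioi 0) := by
  have hec : ContinuousOn (uncurry eos.e) (Ioi 0 ×ˢ Ioi 0) := hG.2.1.continuousOn
  intro q hq
  obtain ⟨ρ₀, E₀⟩ := q
  have hρ₀ : 0 < ρ₀ := hq.1
  have hE₀ : 0 < E₀ := hq.2
  set ϑ₀ := eos.temperature ρ₀ E₀ with hϑ₀def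
  have hϑ₀ : 0 < ϑ₀ := (htemp ρ₀ E₀ hρ₀ hE₀).1
  have hinv₀ : ρ₀ * eos.e ρ₀ ϑ₀ = E₀ := (htemp ρ₀ E₀ hρ₀ hE₀).2
  rw [ContinuousWithinAt, Metric.tendsto_nhds]
  intro ε hε
  -- shrink `ε` so that `ϑ₀ - ε' > 0`
  set ε' := min ε (ϑ₀ / 2) with hε'
  have hε' : 0 < ε' := lt_min hε (half_pos hϑ₀)
  have hε'ε : ε' ≤ ε := min_le_left _ _
  have hlo : 0 < ϑ₀ - ε' := by
    have : ε' ≤ ϑ₀ / 2 := min_le_right _ _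
    linarith
  -- strict monotonicity at `ρ₀`: `ρ₀ e(ρ₀, ϑ₀-ε') < E₀ < ρ₀ e(ρ₀, ϑ₀+ε')`
  have hmono₀ := strictMonoOn_e hG hS hρ₀
  have hplus : E₀ < ρ₀ * eos.e ρ₀ (ϑ₀ + ε') := by
    rw [← hinv₀]
    exact mul_lt_mul_of_pos_left (hmono₀ hϑ₀ (show 0 < ϑ₀ + ε' by linarith) (by linarith)) hρ₀
  have hminus : ρ₀ * eos.e ρ₀ (ϑ₀ - ε') < E₀ := by
    rw [← hinv₀]
    exact mul_lt_mul_of_pos_left (hmono₀ hlo hϑ₀ (by linarith)) hρ₀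
  -- the functions `(ρ,E) ↦ ρ e(ρ, ϑ₀ ± ε') - E` are continuous on the quadrant
  have hcont : ∀ θ : ℝ, 0 < θ →
      ContinuousWithinAt (fun q : ℝ × ℝ => q.1 * eos.e q.1 θ - q.2) (Ioi 0 ×ˢ Ioi 0) (ρ₀, E₀) := by
    intro θ hθ
    have h1 : ContinuousWithinAt (fun q : ℝ × ℝ => eos.e q.1 θ) (Ioi 0 ×ˢ Ioi 0) (ρ₀, E₀) := by
      have hmap : MapsTo (fun q : ℝ × ℝ => (q.1, θ)) (Ioi (0 : ℝ) ×ˢ Ioi (0 : ℝ)) (Ioi 0 ×ˢ Ioi 0) :=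
        fun q hq => ⟨hq.1, hθ⟩
      exact ContinuousWithinAt.comp (f := fun q : ℝ × ℝ => (q.1, θ)) (g := uncurry eos.e)
        (hec (ρ₀, θ) ⟨hρ₀, hθ⟩) ((continuous_fst.prodMk continuous_const).continuousWithinAt) hmap
    exact (continuousWithinAt_fst.mul h1).sub continuousWithinAt_snd
  have hevp : ∀ᶠ q in 𝓝[Ioi 0 ×ˢ Ioi 0] (ρ₀, E₀), 0 < q.1 * eos.e q.1 (ϑ₀ + ε') - q.2 := by
    have := (hcont (ϑ₀ + ε') (by linarith)).eventually (Ioi_mem_nhds (show (0 : ℝ) < ρ₀ * eos.e ρ₀ (ϑ₀ + ε') - E₀ by linarith))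
    exact this
  have hevm : ∀ᶠ q in 𝓝[Ioi 0 ×ˢ Ioi 0] (ρ₀, E₀), q.1 * eos.e q.1 (ϑ₀ - ε') - q.2 < 0 := by
    have := (hcont (ϑ₀ - ε') hlo).eventually (Iio_mem_nhds (show ρ₀ * eos.e ρ₀ (ϑ₀ - ε') - E₀ < 0 by linarith))
    exact this
  filter_upwards [hevp, hevm, self_mem_nhdsWithin] with q hqp hqm hq
  obtain ⟨ρ, E⟩ := q
  have hρ : 0 < ρ := hq.1
  have hE : 0 < E := hq.2
  set ϑ := eos.temperature ρ E with hϑdef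
  have hϑ : 0 < ϑ := (htemp ρ E hρ hE).1
  have hinv : ρ * eos.e ρ ϑ = E := (htemp ρ E hρ hE).2
  have hmono := strictMonoOn_e hG hS hρ
  -- squeeze: `ϑ₀ - ε' < ϑ < ϑ₀ + ε'`
  have hup : ϑ < ϑ₀ + ε' := by
    by_contra hcon
    have hle : ϑ₀ + ε' ≤ ϑ := not_lt.1 hcon
    have : eos.e ρ (ϑ₀ + ε') ≤ eos.e ρ ϑ :=
      (hmono.le_iff_le (show 0 < ϑ₀ + ε' by linarith) hϑ).2 hle
    have := mul_le_mul_of_nonneg_left this hρ.le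
    simp only at hqp
    linarith
  have hdown : ϑ₀ - ε' < ϑ := by
    by_contra hcon
    have hle : ϑ ≤ ϑ₀ - ε' := not_lt.1 hcon
    have : eos.e ρ ϑ ≤ eos.e ρ (ϑ₀ - ε') := (hmono.le_iff_le hϑ hlo).2 hle
    have := mul_le_mul_of_nonneg_left this hρ.le
    simp only at hqm
    linarith
  rw [Real.dist_eq, abs_sub_lt_iff]
  constructor <;> linarith

end EulerEOS

end CompressibleEuler

end Literature.Analysis.FluidPDE
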